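import Literature.NumberTheory.Automorphic.LeviEmbeddingGL
import Literature.NumberTheory.Automorphic.AutomorphicFormsKTranslates
import HarnessLib

/-!
# The Levi embedding `GL_k × GL_l → GL_{k+l}` and the archimedean calculus: exponentials of block
# diagonal matrices, Lie derivatives and the word action along the two factors
(Borel–Jacquet 1979, §1.5 and 4.4; Knapp 2002, 0.§2)

Topic `NumberTheory/Automorphic`; sequel of `LeviEmbeddingGL`. The differential of the Levi
embedding `leviGL` at the archimedean places is the block embedding `inclLeftR`, `inclRightR` of
`HarishChandraLeviIntegralReal` (`diag(X, 0)`, `diag(0, Y)`); this file proves the consequences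
for the archimedean calculus of functions on `GL_{k+l}(𝔸_K)` restricted to the Levi
(`ArchimedeanCalculus`: `lieDeriv`, `iterLieDeriv`, `applyFree` for the inclusions
`glArch m K : GL_m(K_∞) → GL_m(𝔸_K)`):

* `HCLevi.exp_blockDiag'` — **`exp diag(X, Y) = diag(exp X, exp Y)`** (`diag` is a continuous ring
  homomorphism from the product algebra, so Mathlib's `NormedSpace.map_exp` and `Prod.fst_exp` apply —
  no power series manipulation); `leviGL_expGL`, `glArch_expMem_smul_inclLeftLie`,
  `glArch_expMem_smul_inclRightLie` — the one-parameter subgroups of the factors inside `GL_{k+l}(𝔸_K)`;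
* `lieDeriv_comp_leviGL_left` / `_right` — **the Lie derivative of the restriction
  `m₁ ↦ ψ (diag(m₁, m₂))` along `X ∈ 𝔤𝔩_k(K_∞)` is the Lie derivative of `ψ` along `diag(X, 0)` at
  `diag(m₁, m₂)`** (and symmetrically in the second factor); iterated: `iterLieDeriv_comp_leviGL_left`
  / `_right`; for the word action: `applyFree_comp_leviGL_left` / `_right`, through the substitution
  of letters `liftInclLeft`, `liftInclRight : ℝ⟨𝔤𝔩_k⟩, ℝ⟨𝔤𝔩_l⟩ → ℝ⟨𝔤𝔩_{k+l}⟩`, with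
  `envToMat_freeToEnveloping_liftInclLeft` identifying their images in `U(𝔤𝔩_{k+l}(K_∞))` with `jLeftR`,
  `jRightR` through the isomorphisms `envToMat`/`envOfMat` between `U((archGroupGL m K).lie)` and
  `U(𝔤𝔩_m(K_∞))` (the `(archGroupGL m K).lie`-typed form of `HCLevi.topEnvEquiv`), and
  `envOfMat_mem_span_of_mem_uRightR` carrying the right ideal `𝔲·U` to the form consumed by
  `ArchimedeanRightIdealVanishing`.

This is the calculus by which the `Z(𝔤𝔩_k(K_w))`-finiteness of constant terms along the Levi
(Harish-Chandra's transfer, `HarishChandraLeviIntegralPlaces`) becomes `Z`-finiteness of the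
restricted functions on `GL_k(𝔸_K)`, `GL_l(𝔸_K)` (Borel–Jacquet 1979, 4.4; Moeglin–Waldspurger
1995, I.2.17). Everything here is proved; the definitions are `blockDiag'RingHom`, `inclLeftLie`, `inclRightLie`,
`liftInclLeft`, `liftInclRight`, `lieToMat`, `matToLie`, `envToMat`, `envOfMat`.

## References

* A. Borel, H. Jacquet, *Automorphic forms and automorphic representations* (1979), §1.5, 4.4
  [BorelJacquet1979].
* A. W. Knapp, *Lie Groups Beyond an Introduction*, 2nd ed. (2002), 0.§2 [Knapp2002].
-/

-- Mathlib idiom (Mathlib/Algebra/Lie/OfAssociative.lean); needed to mention Lie subalgebras of matrix algebras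
attribute [local instance 100] LieRing.ofAssociativeRing

noncomputable section

open scoped Matrix MatrixGroups Classical
open NumberField IsDedekindDomain NormedSpace

namespace Literature.NumberTheory.Automorphic

/-! ### 1. Exponentials of block diagonal matrices -/

namespace HCLevi

section Exp

variable (A : Type*) [NormedCommRing A] (k l : ℕ)

/-- `diag : 𝔤𝔩_k(A) × 𝔤𝔩_l(A) → 𝔤𝔩_{k+l}(A)` as a ring homomorphism from the product algebra.
[folklore] -/
def blockDiag'RingHom : (Matrix (Fin k) (Fin k) A × Matrix (Fin l) (Fin l) A) →+* Matrix (Fin (k + l)) (Fin (k + l)) A where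
  toFun p := blockDiag' A p.1 p.2
  map_one' := blockDiag'_one
  map_mul' _ _ := (blockDiag'_mul _ _ _ _).symm
  map_zero' := blockDiag'_zero
  map_add' _ _ := blockDiag'_add _ _ _ _

variable {A k l}

/-- `blockDiag'RingHom A k l (X, Y) = diag(X, Y)`. [folklore] -/
@[simp]
theorem blockDiag'RingHom_apply (p : Matrix (Fin k) (Fin k) A × Matrix (Fin l) (Fin l) A) :
    blockDiag'RingHom A k l p = blockDiag' A p.1 p.2 :=
  rfl

-- As in Mathlib's `MatrixExponential` and the tree's `RealMatrixGroups`: the scoped `L∞`-operator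
-- normed ring structure on matrices is only reducibly-defeq to the Pi uniformity.
set_option backward.isDefEq.respectTransparency false in
open scoped Matrix.Norms.Operator in
/-- **`exp diag(X, Y) = diag(exp X, exp Y)`**: `diag` is a continuous ring homomorphism from the
product algebra, and `exp (X, Y) = (exp X, exp Y)` (Mathlib's `NormedSpace.map_exp`, `Prod.fst_exp`).
Knapp 2002, 0.§2. [folklore] -/
theorem exp_blockDiag' [NormedAlgebra ℚ A] [CompleteSpace A] (X : Matrix (Fin k) (Fin k) A) (Y : Matrix (Fin l) (Fin l) A) :
    exp (blockDiag' A X Y) = blockDiag' A (exp X) (exp Y) := by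
  have hc : Continuous (blockDiag'RingHom A k l) := continuous_blockDiag'
  have h := map_exp (blockDiag'RingHom A k l) hc (X, Y)
  rw [blockDiag'RingHom_apply, blockDiag'RingHom_apply] at h
  rw [← h, Prod.fst_exp, Prod.snd_exp]

end Exp

end HCLevi

/-! ### 2. One-parameter subgroups of the two factors -/

section OneParam

open HCLevi

variable {A : Type*} [NormedCommRing A] [NormedAlgebra ℚ A] [CompleteSpace A] {k l : ℕ}

/-- `diag(exp X, exp Y) = exp diag(X, Y)` in `GL_{k+l}(A)`. [folklore] -/
theorem leviGL_expGL (X : Matrix (Fin k) (Fin k) A) (Y : Matrix (Fin l) (Fin l) A) :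
    leviGL A k l (expGL X, expGL Y) = expGL (blockDiag' A X Y) :=
  Units.ext (by rw [coe_leviGL, coe_expGL, coe_expGL, coe_expGL, exp_blockDiag'])

/-- `diag(exp X, 1) = exp diag(X, 0)`. [folklore] -/
theorem leviGL_expGL_inl (X : Matrix (Fin k) (Fin k) A) :
    leviGL A k l (expGL X, 1) = expGL (blockDiag' A X 0) := by
  rw [← expGL_zero, leviGL_expGL]

/-- `diag(1, exp Y) = exp diag(0, Y)`. [folklore] -/
theorem leviGL_expGL_inr (Y : Matrix (Fin l) (Fin l) A) :
    leviGL A k l (1, expGL Y) = expGL (blockDiag' A 0 Y) := by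
  rw [← expGL_zero, leviGL_expGL]

end OneParam

section ArchDatum

open NumberField.mixedEmbedding HCLevi

variable {K : Type} [Field K] [NumberField K] {k l : ℕ}

variable (k l) in
/-- The first block embedding `X ↦ diag(X, 0)` on the Lie algebras of the archimedean groups
`GL_k(K_∞) → GL_{k+l}(K_∞)` (`inclLeftR` of `HarishChandraLeviIntegralReal`, between the `⊤` Lie
subalgebras of `ArchimedeanCalculus`). [folklore] -/
def inclLeftLie (X : (archGroupGL k K).lie) : (archGroupGL (k + l) K).lie :=
  ⟨inclLeftR k l (X : Matrix (Fin k) (Fin k) (mixedSpace K)), LieSubalgebra.mem_top _⟩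

variable (k l) in
/-- The second block embedding `Y ↦ diag(0, Y)` on the Lie algebras of the archimedean groups.
[folklore] -/
def inclRightLie (Y : (archGroupGL l K).lie) : (archGroupGL (k + l) K).lie :=
  ⟨inclRightR k l (Y : Matrix (Fin l) (Fin l) (mixedSpace K)), LieSubalgebra.mem_top _⟩

/-- `inclLeftLie X = diag(X, 0)` as a matrix. [folklore] -/
@[simp]
theorem coe_inclLeftLie (X : (archGroupGL k K).lie) :
    ((inclLeftLie k l X : (archGroupGL (k + l) K).lie) : Matrix (Fin (k + l)) (Fin (k + l)) (mixedSpace K)) =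
      blockDiag' (mixedSpace K) (X : Matrix (Fin k) (Fin k) (mixedSpace K)) 0 :=
  rfl

/-- `inclRightLie Y = diag(0, Y)` as a matrix. [folklore] -/
@[simp]
theorem coe_inclRightLie (Y : (archGroupGL l K).lie) :
    ((inclRightLie k l Y : (archGroupGL (k + l) K).lie) : Matrix (Fin (k + l)) (Fin (k + l)) (mixedSpace K)) =
      blockDiag' (mixedSpace K) 0 (Y : Matrix (Fin l) (Fin l) (mixedSpace K)) :=
  rfl

/-- **The one-parameter subgroup of the first factor**: `(exp t·diag(X, 0), 1) = diag((exp tX, 1), 1)`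
in `GL_{k+l}(𝔸_K)`. [folklore] -/
theorem glArch_expMem_smul_inclLeftLie (t : ℝ) (X : (archGroupGL k K).lie) :
    glArch (k + l) K ((archGroupGL (k + l) K).expMem (t • inclLeftLie k l X)) =
      leviGL (AdeleRing (𝓞 K) K) k l (glArch k K ((archGroupGL k K).expMem (t • X)), 1) := by
  rw [glArch_apply, glArch_apply, RealMatrixGroup.coe_expMem, RealMatrixGroup.coe_expMem]
  have e1 : ((t • inclLeftLie k l X : (archGroupGL (k + l) K).lie) : Matrix (Fin (k + l)) (Fin (k + l)) (mixedSpace K)) =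
      blockDiag' (mixedSpace K) (t • (X : Matrix (Fin k) (Fin k) (mixedSpace K))) 0 := by
    change t • blockDiag' (mixedSpace K) (X : Matrix (Fin k) (Fin k) (mixedSpace K)) 0 = _
    rw [← blockDiag'_smul, smul_zero]
  have e2 : ((t • X : (archGroupGL k K).lie) : Matrix (Fin k) (Fin k) (mixedSpace K)) =
      t • (X : Matrix (Fin k) (Fin k) (mixedSpace K)) := rfl
  rw [e1, e2, ← leviGL_expGL_inl, GLn.ofInfinite_leviGL, map_one]

/-- **The one-parameter subgroup of the second factor**: `(exp t·diag(0, Y), 1) = diag(1, (exp tY, 1))`.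
[folklore] -/
theorem glArch_expMem_smul_inclRightLie (t : ℝ) (Y : (archGroupGL l K).lie) :
    glArch (k + l) K ((archGroupGL (k + l) K).expMem (t • inclRightLie k l Y)) =
      leviGL (AdeleRing (𝓞 K) K) k l (1, glArch l K ((archGroupGL l K).expMem (t • Y))) := by
  rw [glArch_apply, glArch_apply, RealMatrixGroup.coe_expMem, RealMatrixGroup.coe_expMem]
  have e1 : ((t • inclRightLie k l Y : (archGroupGL (k + l) K).lie) : Matrix (Fin (k + l)) (Fin (k + l)) (mixedSpace K)) =
      blockDiag' (mixedSpace K) 0 (t • (Y : Matrix (Fin l) (Fin l) (mixedSpace K))) := by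
    change t • blockDiag' (mixedSpace K) 0 (Y : Matrix (Fin l) (Fin l) (mixedSpace K)) = _
    rw [← blockDiag'_smul, smul_zero]
  have e2 : ((t • Y : (archGroupGL l K).lie) : Matrix (Fin l) (Fin l) (mixedSpace K)) =
      t • (Y : Matrix (Fin l) (Fin l) (mixedSpace K)) := rfl
  rw [e1, e2, ← leviGL_expGL_inr, GLn.ofInfinite_leviGL, map_one]

/-! ### 3. Lie derivatives along the two factors -/

/-- **Lie derivatives of the restriction to the Levi, first factor.** For `ψ : GL_{k+l}(𝔸_K) → ℂ`,
`m₂ ∈ GL_l(𝔸_K)` and `X ∈ 𝔤𝔩_k(K_∞)`: the Lie derivative along `X` of `m₁ ↦ ψ (diag(m₁, m₂))` at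
`m₁` is the Lie derivative of `ψ` along `diag(X, 0)` at `diag(m₁, m₂)`
(`diag(m₁ exp tX, m₂) = diag(m₁, m₂) exp t·diag(X, 0)`). Borel–Jacquet 1979, §1.5 with 4.4.
[cite: BorelJacquet1979, 4.4] -/
theorem lieDeriv_comp_leviGL_left (ψ : GL (Fin (k + l)) (AdeleRing (𝓞 K) K) → ℂ)
    (m₂ : GL (Fin l) (AdeleRing (𝓞 K) K)) (X : (archGroupGL k K).lie) (m₁ : GL (Fin k) (AdeleRing (𝓞 K) K)) :
    lieDeriv (glArch k K) X (fun m₁ => ψ (leviGL (AdeleRing (𝓞 K) K) k l (m₁, m₂))) m₁ =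
      lieDeriv (glArch (k + l) K) (inclLeftLie k l X) ψ (leviGL (AdeleRing (𝓞 K) K) k l (m₁, m₂)) := by
  simp only [lieDeriv]
  congr 1
  funext t
  rw [glArch_expMem_smul_inclLeftLie, ← map_mul, Prod.mk_mul_mk, mul_one]

/-- **Lie derivatives of the restriction to the Levi, second factor.** [cite: BorelJacquet1979, 4.4] -/
theorem lieDeriv_comp_leviGL_right (ψ : GL (Fin (k + l)) (AdeleRing (𝓞 K) K) → ℂ)
    (m₁ : GL (Fin k) (AdeleRing (𝓞 K) K)) (Y : (archGroupGL l K).lie) (m₂ : GL (Fin l) (AdeleRing (𝓞 K) K)) :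
    lieDeriv (glArch l K) Y (fun m₂ => ψ (leviGL (AdeleRing (𝓞 K) K) k l (m₁, m₂))) m₂ =
      lieDeriv (glArch (k + l) K) (inclRightLie k l Y) ψ (leviGL (AdeleRing (𝓞 K) K) k l (m₁, m₂)) := by
  simp only [lieDeriv]
  congr 1
  funext t
  rw [glArch_expMem_smul_inclRightLie, ← map_mul, Prod.mk_mul_mk, mul_one]

/-- **Iterated Lie derivatives of the restriction to the Levi, first factor**: along a word `w` in
`𝔤𝔩_k(K_∞)` they are the iterated Lie derivatives of `ψ` along the word `diag(w, 0)`, restricted.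
[cite: BorelJacquet1979, 4.4] -/
theorem iterLieDeriv_comp_leviGL_left (w : List (archGroupGL k K).lie)
    (ψ : GL (Fin (k + l)) (AdeleRing (𝓞 K) K) → ℂ) (m₂ : GL (Fin l) (AdeleRing (𝓞 K) K)) :
    iterLieDeriv (glArch k K) w (fun m₁ => ψ (leviGL (AdeleRing (𝓞 K) K) k l (m₁, m₂))) =
      fun m₁ => iterLieDeriv (glArch (k + l) K) (w.map (inclLeftLie k l)) ψ
        (leviGL (AdeleRing (𝓞 K) K) k l (m₁, m₂)) := by
  induction w with
  | nil => rfl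
  | cons X w ih =>
    rw [iterLieDeriv_cons, ih, List.map_cons, iterLieDeriv_cons]
    funext m₁
    exact lieDeriv_comp_leviGL_left _ m₂ X m₁

/-- **Iterated Lie derivatives of the restriction to the Levi, second factor.**
[cite: BorelJacquet1979, 4.4] -/
theorem iterLieDeriv_comp_leviGL_right (w : List (archGroupGL l K).lie)
    (ψ : GL (Fin (k + l)) (AdeleRing (𝓞 K) K) → ℂ) (m₁ : GL (Fin k) (AdeleRing (𝓞 K) K)) :
    iterLieDeriv (glArch l K) w (fun m₂ => ψ (leviGL (AdeleRing (𝓞 K) K) k l (m₁, m₂))) =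
      fun m₂ => iterLieDeriv (glArch (k + l) K) (w.map (inclRightLie k l)) ψ
        (leviGL (AdeleRing (𝓞 K) K) k l (m₁, m₂)) := by
  induction w with
  | nil => rfl
  | cons Y w ih =>
    rw [iterLieDeriv_cons, ih, List.map_cons, iterLieDeriv_cons]
    funext m₂
    exact lieDeriv_comp_leviGL_right _ m₁ Y m₂

/-! ### 4. The word action along the two factors -/

variable (k l) in
/-- Substitution of letters `X ↦ diag(X, 0)`: the algebra map `ℝ⟨𝔤𝔩_k(K_∞)⟩ → ℝ⟨𝔤𝔩_{k+l}(K_∞)⟩`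
induced by `inclLeftLie`. [folklore] -/
def liftInclLeft : FreeAlgebra ℝ (archGroupGL k K).lie →ₐ[ℝ] FreeAlgebra ℝ (archGroupGL (k + l) K).lie :=
  FreeAlgebra.lift ℝ (FreeAlgebra.ι ℝ ∘ inclLeftLie k l)

variable (k l) in
/-- Substitution of letters `Y ↦ diag(0, Y)`. [folklore] -/
def liftInclRight : FreeAlgebra ℝ (archGroupGL l K).lie →ₐ[ℝ] FreeAlgebra ℝ (archGroupGL (k + l) K).lie :=
  FreeAlgebra.lift ℝ (FreeAlgebra.ι ℝ ∘ inclRightLie k l)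

/-- `liftInclLeft` on letters. [folklore] -/
@[simp]
theorem liftInclLeft_ι (X : (archGroupGL k K).lie) :
    liftInclLeft k l (FreeAlgebra.ι ℝ X) = FreeAlgebra.ι ℝ (inclLeftLie k l X) :=
  FreeAlgebra.lift_ι_apply _ _

/-- `liftInclRight` on letters. [folklore] -/
@[simp]
theorem liftInclRight_ι (Y : (archGroupGL l K).lie) :
    liftInclRight k l (FreeAlgebra.ι ℝ Y) = FreeAlgebra.ι ℝ (inclRightLie k l Y) :=
  FreeAlgebra.lift_ι_apply _ _

/-- Substitution of letters across alphabets maps word basis vectors to word basis vectors.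
[folklore] -/
theorem lift_ι_comp_basisFreeMonoid' {R : Type*} [CommSemiring R] {X Y : Type*} (f : X → Y) (w : FreeMonoid X) :
    FreeAlgebra.lift R (FreeAlgebra.ι R ∘ f) (FreeAlgebra.basisFreeMonoid R X w) =
      FreeAlgebra.basisFreeMonoid R Y (FreeMonoid.map f w) := by
  rw [basisFreeMonoid_eq_lift, basisFreeMonoid_eq_lift]
  have key : (FreeAlgebra.lift R (FreeAlgebra.ι R ∘ f)).toMonoidHom.comp
      (FreeMonoid.lift (FreeAlgebra.ι R)) =
        (FreeMonoid.lift (FreeAlgebra.ι R)).comp (FreeMonoid.map f) :=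
    FreeMonoid.hom_eq fun x => by simp
  exact DFunLike.congr_fun key w

/-- **The word action after substituting letters across alphabets**: for `f : 𝔤₁ → 𝔤₂` and any two
archimedean inclusions, `(lift f p) φ = ∑_w c_w · (f X₁) (⋯ ((f Xₙ) φ))` where `p = ∑_w c_w X₁ ⋯ Xₙ`.
[cite: BorelJacquet1979, §1.6] -/
theorem applyFree_lift_comp' {A : Type*} [NormedCommRing A] [NormedAlgebra ℝ A] [NormedAlgebra ℚ A]
    [CompleteSpace A] [StarRing A] {N₁ N₂ : Type*} [Fintype N₁] [DecidableEq N₁] [Fintype N₂] [DecidableEq N₂]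
    {H₁ : RealMatrixGroup A N₁} {H₂ : RealMatrixGroup A N₂} {G₂ : Type*} [Group G₂]
    (ι₂ : H₂.carrier →* G₂) (f : H₁.lie → H₂.lie)
    (p : FreeAlgebra ℝ H₁.lie) (φ : G₂ → ℂ) :
    applyFree ι₂ (FreeAlgebra.lift ℝ (FreeAlgebra.ι ℝ ∘ f) p) φ =
      ((FreeAlgebra.basisFreeMonoid ℝ H₁.lie).repr p).sum
        fun w c => (c : ℂ) • iterLieDeriv ι₂ ((FreeMonoid.toList w).map f) φ := by
  let L : FreeAlgebra ℝ H₂.lie →ₗ[ℝ] (G₂ → ℂ) :=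
    { toFun := fun q => applyFree ι₂ q φ
      map_add' := fun q₁ q₂ => applyFree_add ι₂ q₁ q₂ φ
      map_smul' := fun c q => by
        rw [applyFree_smul_left, RingHom.id_apply, Complex.coe_smul] }
  have hL : ∀ q, applyFree ι₂ q φ = L q := fun q => rfl
  set b := FreeAlgebra.basisFreeMonoid ℝ H₁.lie with hb
  conv_lhs => rw [← b.linearCombination_repr p, Finsupp.linearCombination_apply, map_finsuppSum,
    hL, map_finsuppSum]
  refine Finsupp.sum_congr fun w _ => ?_
  rw [map_smul, map_smul, lift_ι_comp_basisFreeMonoid', ← hL, applyFree_basisFreeMonoid,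
    FreeMonoid.toList_map, Complex.coe_smul]

/-- **The word action along the first factor of the Levi**: for `p ∈ ℝ⟨𝔤𝔩_k(K_∞)⟩`,
`(p · (m₁ ↦ ψ (diag(m₁, m₂)))) (m₁) = ((lift p) ψ) (diag(m₁, m₂))`, `lift = liftInclLeft`.
Borel–Jacquet 1979, §1.5–1.6 with 4.4. [cite: BorelJacquet1979, 4.4] -/
theorem applyFree_comp_leviGL_left (p : FreeAlgebra ℝ (archGroupGL k K).lie)
    (ψ : GL (Fin (k + l)) (AdeleRing (𝓞 K) K) → ℂ) (m₂ : GL (Fin l) (AdeleRing (𝓞 K) K)) :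
    applyFree (glArch k K) p (fun m₁ => ψ (leviGL (AdeleRing (𝓞 K) K) k l (m₁, m₂))) =
      fun m₁ => applyFree (glArch (k + l) K) (liftInclLeft k l p) ψ (leviGL (AdeleRing (𝓞 K) K) k l (m₁, m₂)) := by
  funext m₁
  rw [liftInclLeft, applyFree_lift_comp' (glArch (k + l) K) (inclLeftLie k l) p ψ]
  unfold applyFree
  simp only [Finsupp.sum, Finset.sum_apply, Pi.smul_apply]
  refine Finset.sum_congr rfl fun w _ => ?_
  rw [iterLieDeriv_comp_leviGL_left]

/-- **The word action along the second factor of the Levi.** [cite: BorelJacquet1979, 4.4] -/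
theorem applyFree_comp_leviGL_right (p : FreeAlgebra ℝ (archGroupGL l K).lie)
    (ψ : GL (Fin (k + l)) (AdeleRing (𝓞 K) K) → ℂ) (m₁ : GL (Fin k) (AdeleRing (𝓞 K) K)) :
    applyFree (glArch l K) p (fun m₂ => ψ (leviGL (AdeleRing (𝓞 K) K) k l (m₁, m₂))) =
      fun m₂ => applyFree (glArch (k + l) K) (liftInclRight k l p) ψ (leviGL (AdeleRing (𝓞 K) K) k l (m₁, m₂)) := by
  funext m₂
  rw [liftInclRight, applyFree_lift_comp' (glArch (k + l) K) (inclRightLie k l) p ψ]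
  unfold applyFree
  simp only [Finsupp.sum, Finset.sum_apply, Pi.smul_apply]
  refine Finset.sum_congr rfl fun w _ => ?_
  rw [iterLieDeriv_comp_leviGL_right]

/-! ### 5. Images in the enveloping algebra of the matrix algebra -/

variable (K) in
/-- The inclusion of the Lie algebra `(archGroupGL m K).lie` (all of `𝔤𝔩_m(K_∞)`) into the matrix
algebra, as a Lie algebra map (`LieSubalgebra.incl`, kept in the syntactic form of `ArchimedeanCalculus`).
[folklore] -/
def lieToMat (m : ℕ) : (archGroupGL m K).lie →ₗ⁅ℝ⁆ Matrix (Fin m) (Fin m) (mixedSpace K) :=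
  (archGroupGL m K).lie.incl

variable (K) in
/-- The inverse Lie algebra map `𝔤𝔩_m(K_∞) → (archGroupGL m K).lie` (every matrix lies in `⊤`).
[folklore] -/
def matToLie (m : ℕ) : Matrix (Fin m) (Fin m) (mixedSpace K) →ₗ⁅ℝ⁆ (archGroupGL m K).lie where
  toFun X := ⟨X, LieSubalgebra.mem_top X⟩
  map_add' _ _ := rfl
  map_smul' _ _ := rfl
  map_lie' {_ _} := rfl

/-- `lieToMat K m X = X` as a matrix. [folklore] -/
@[simp]
theorem lieToMat_apply {m : ℕ} (X : (archGroupGL m K).lie) :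
    lieToMat K m X = (X : Matrix (Fin m) (Fin m) (mixedSpace K)) :=
  rfl

/-- The matrix of `matToLie K m X` is `X`. [folklore] -/
@[simp]
theorem coe_matToLie {m : ℕ} (X : Matrix (Fin m) (Fin m) (mixedSpace K)) :
    ((matToLie K m X : (archGroupGL m K).lie) : Matrix (Fin m) (Fin m) (mixedSpace K)) = X :=
  rfl

variable (K) in
/-- **`U((archGroupGL m K).lie) → U(𝔤𝔩_m(K_∞))`**, the algebra map induced by `lieToMat` (an
isomorphism, inverse `envOfMat`; the `(archGroupGL m K).lie`-typed form of `HCLevi.topEnvEquiv`).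
[folklore] -/
def envToMat (m : ℕ) : UniversalEnvelopingAlgebra ℝ (archGroupGL m K).lie →ₐ[ℝ]
    UniversalEnvelopingAlgebra ℝ (Matrix (Fin m) (Fin m) (mixedSpace K)) :=
  UniversalEnvelopingAlgebra.lift ℝ ((UniversalEnvelopingAlgebra.ι ℝ).comp (lieToMat K m))

variable (K) in
/-- **`U(𝔤𝔩_m(K_∞)) → U((archGroupGL m K).lie)`**, the algebra map induced by `matToLie`. [folklore] -/
def envOfMat (m : ℕ) : UniversalEnvelopingAlgebra ℝ (Matrix (Fin m) (Fin m) (mixedSpace K)) →ₐ[ℝ]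
    UniversalEnvelopingAlgebra ℝ (archGroupGL m K).lie :=
  UniversalEnvelopingAlgebra.lift ℝ ((UniversalEnvelopingAlgebra.ι ℝ).comp (matToLie K m))

/-- `envToMat` on generators. [folklore] -/
@[simp]
theorem envToMat_ι {m : ℕ} (X : (archGroupGL m K).lie) :
    envToMat K m (UniversalEnvelopingAlgebra.ι ℝ X) =
      UniversalEnvelopingAlgebra.ι ℝ (X : Matrix (Fin m) (Fin m) (mixedSpace K)) :=
  UniversalEnvelopingAlgebra.lift_ι_apply ℝ _ X

/-- `envOfMat` on generators. [folklore] -/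
@[simp]
theorem envOfMat_ι {m : ℕ} (X : Matrix (Fin m) (Fin m) (mixedSpace K)) :
    envOfMat K m (UniversalEnvelopingAlgebra.ι ℝ X) = UniversalEnvelopingAlgebra.ι ℝ (matToLie K m X) :=
  UniversalEnvelopingAlgebra.lift_ι_apply ℝ _ X

/-- `envToMat ∘ envOfMat = id`. [folklore] -/
theorem envToMat_envOfMat {m : ℕ} (u : UniversalEnvelopingAlgebra ℝ (Matrix (Fin m) (Fin m) (mixedSpace K))) :
    envToMat K m (envOfMat K m u) = u := by
  have h : (envToMat K m).comp (envOfMat K m) = AlgHom.id ℝ _ := by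
    refine UniversalEnvelopingAlgebra.hom_ext (h := LieHom.ext fun X => ?_)
    simp only [LieHom.coe_comp, Function.comp_apply, AlgHom.coe_toLieHom, AlgHom.coe_comp, envOfMat_ι, envToMat_ι,
      coe_matToLie, AlgHom.coe_id, id_eq]
  exact congr($h u)

/-- `envOfMat ∘ envToMat = id`. [folklore] -/
theorem envOfMat_envToMat {m : ℕ} (u : UniversalEnvelopingAlgebra ℝ (archGroupGL m K).lie) :
    envOfMat K m (envToMat K m u) = u := by
  have h : (envOfMat K m).comp (envToMat K m) = AlgHom.id ℝ _ := by
    refine UniversalEnvelopingAlgebra.hom_ext (h := LieHom.ext fun X => ?_)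
    simp only [LieHom.coe_comp, Function.comp_apply, AlgHom.coe_toLieHom, AlgHom.coe_comp, envToMat_ι, envOfMat_ι,
      AlgHom.coe_id, id_eq]
    rfl
  exact congr($h u)

/-- `envOfMat` maps the centre of `U(𝔤𝔩_m(K_∞))` into the centre `centerU (archGroupGL m K)` (it is an
isomorphism). [folklore] -/
theorem envOfMat_mem_center {m : ℕ} {z : UniversalEnvelopingAlgebra ℝ (Matrix (Fin m) (Fin m) (mixedSpace K))}
    (hz : z ∈ Subalgebra.center ℝ (UniversalEnvelopingAlgebra ℝ (Matrix (Fin m) (Fin m) (mixedSpace K)))) :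
    envOfMat K m z ∈ Subalgebra.center ℝ (UniversalEnvelopingAlgebra ℝ (archGroupGL m K).lie) := by
  rw [Subalgebra.mem_center_iff]
  intro u
  have hu : u = envOfMat K m (envToMat K m u) := (envOfMat_envToMat u).symm
  rw [hu, ← map_mul, ← map_mul, Subalgebra.mem_center_iff.mp hz]

/-- **`envToMat ∘ freeToEnveloping ∘ liftInclLeft = jLeftR ∘ envToMat ∘ freeToEnveloping`**: in the
matrix enveloping algebras, the image of `liftInclLeft q` is `jLeftR` of the image of `q`. [folklore] -/
theorem envToMat_freeToEnveloping_liftInclLeft (q : FreeAlgebra ℝ (archGroupGL k K).lie) :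
    envToMat K (k + l) (freeToEnveloping (archGroupGL (k + l) K) (liftInclLeft k l q)) =
      HCLevi.jLeftR k l (envToMat K k (freeToEnveloping (archGroupGL k K) q)) := by
  induction q using FreeAlgebra.induction with
  | grade0 r => simp only [AlgHom.commutes]
  | grade1 X =>
    rw [liftInclLeft_ι, freeToEnveloping_ι, freeToEnveloping_ι, envToMat_ι, envToMat_ι, HCLevi.jLeftR_ι]
    rfl
  | mul a b ha hb => simp only [map_mul, ha, hb]
  | add a b ha hb => simp only [map_add, ha, hb]

/-- **`envToMat ∘ freeToEnveloping ∘ liftInclRight = jRightR ∘ envToMat ∘ freeToEnveloping`.**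
[folklore] -/
theorem envToMat_freeToEnveloping_liftInclRight (q : FreeAlgebra ℝ (archGroupGL l K).lie) :
    envToMat K (k + l) (freeToEnveloping (archGroupGL (k + l) K) (liftInclRight k l q)) =
      HCLevi.jRightR k l (envToMat K l (freeToEnveloping (archGroupGL l K) q)) := by
  induction q using FreeAlgebra.induction with
  | grade0 r => simp only [AlgHom.commutes]
  | grade1 Y =>
    rw [liftInclRight_ι, freeToEnveloping_ι, freeToEnveloping_ι, envToMat_ι, envToMat_ι, HCLevi.jRightR_ι]
    rfl
  | mul a b ha hb => simp only [map_mul, ha, hb]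
  | add a b ha hb => simp only [map_add, ha, hb]

/-- **The right ideal `𝔲·U` of `HarishChandraLeviIntegralReal` maps into the right span of the upper
right block in `U((archGroupGL (k+l) K).lie)`** (the hypothesis `hp` of
`applyFree_apply_eq_zero_of_mem_rightSpan` of `ArchimedeanRightIdealVanishing`). [folklore] -/
theorem envOfMat_mem_span_of_mem_uRightR {w : UniversalEnvelopingAlgebra ℝ (Matrix (Fin (k + l)) (Fin (k + l)) (mixedSpace K))}
    (hw : w ∈ HCLevi.uRightR (𝕜 := mixedSpace K) k l) :
    envOfMat K (k + l) w ∈ Submodule.span ℝ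
      {w' | ∃ X ∈ {X : (archGroupGL (k + l) K).lie | (X : Matrix (Fin (k + l)) (Fin (k + l)) (mixedSpace K)) ∈
          HCLevi.uBlockR (𝕜 := mixedSpace K) k l},
        ∃ a : UniversalEnvelopingAlgebra ℝ (archGroupGL (k + l) K).lie, UniversalEnvelopingAlgebra.ι ℝ X * a = w'} := by
  induction hw using Submodule.span_induction with
  | mem x hx =>
    obtain ⟨X, hX, a, rfl⟩ := hx
    rw [map_mul, envOfMat_ι]
    exact Submodule.subset_span ⟨matToLie K (k + l) X, hX, envOfMat K (k + l) a, rfl⟩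
  | zero => rw [map_zero]; exact Submodule.zero_mem _
  | add x y _ _ hx hy => rw [map_add]; exact Submodule.add_mem _ hx hy
  | smul c x _ hx => rw [map_smul]; exact Submodule.smul_mem _ c hx

end ArchDatum

end Literature.NumberTheory.Automorphic
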